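import Summits.QuantumFields.BalabanUV.T4Continuum.Support.NE7LongitudinalLineLiftEnergy
import HarnessLib

/-!
# NE7TensorBlockLift — THE TENSOR LIFT `tlift M N κ w` OF A COARSE 1-FORM COMPONENT: an EXACT right inverse of Bałaban's one-shot block-LINE average at scale `M`
# (`Σ_{v∈[0,M)^d} Σ_{i<M} tlift w (M•x + v + i e_κ) = M^d • w x`) whose transverse fine differences cost `O(M^{d−4})` × the coarse differences of `w`

Lineage `b2b-balaban-t4-ne7-p1` (CRUX PROVER NE7 #1 = OWNER of BINDER row NE7), generation 116 — fifth brick of the UNIFORM UPPER BOUND for the flat-background effective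
quadratic form (ROAD-G116 §6(U)).  Tensorisation of the one-coordinate bricks: the longitudinal lift ✓ `NE7LongitudinalLineLift.llift` in the direction `κ` of the
component, then the block-mean-exact smooth lift ✓ `NE7CoordinateBlockMeanLift.clift` in every transverse direction (they commute with the relevant translations, so the
order is immaterial for the estimates):
  `tlift M N κ w = clifts M (transverse κ) (llift M N κ (w ∘ blk M))`, `clifts M [ν₁,…,ν_m] = clift M ν₁ ∘ ⋯ ∘ clift M ν_m`.
WHAT ([folklore]; defs `clifts`, `transverse`, `tlift`; 0 sorry): §1 `clifts` bookkeeping, the FIBRE LEMMA `sum_periodBox_fibre`, `sum_periodBox_clifts`;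
§2 **`sum_block_line_tlift`** (EXACTNESS, the shape of ✓ `NE3BlockLineAverage.iterate_Qcoarse_apply` with `M = L^k`); §3 ENERGY `sum_normSq_clifts_le`, `sum_normSq_step_clifts_le`,
**`sum_normSq_step_tlift_le`**: `Σ_{y∈[0,MN)^d} ‖tlift w (y + e_ν) − tlift w (y)‖² ≤ 166176·36^d·(1/M)^4·M^d·Σ_{z∈[0,N)^d} ‖w(z + e_ν) − w(z)‖²` (`ν ≠ κ`) — UNIFORM IN `M` FOR `d = 4`.
HONEST FRAMING: pure lattice calculus (kinematics of block averaging); nothing about Bałaban's minimisers; NOT NE7 as a spine node; spine 0∕9; NOT infinite volume,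
NOT mass gap, NOT BetaPertH, NOT Clay.
-/

set_option autoImplicit false

open scoped BigOperators
open Finset

namespace Summit.QuantumFields.BalabanUV.T4Continuum.NE7TensorBlockLift

open Literature.MathematicalPhysics.QuantumFieldTheory.Balaban1983to89
open B7Prop1Explicit
open T4AveragingDeficitWallBoundary (periodBox mem_periodBox card_periodBox sum_periodBox_shift)
open SmoothRefineBlocks (blk res blk_add_res res_nonneg res_lt blk_res_eq_of blk_res_add_period res_add_e_self res_add_e_ne)
open NE3BlockLineAverage (sum_univ_boxVec sum_periodBox_blocks)
open NE3CoarseInterpolant (blk_block)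
open NE7CoordinateLiftWeights
open NE7CoordinateBlockMeanLift
open NE7LongitudinalLineLift
open NE7LongitudinalLineLiftEnergy

noncomputable section

variable {d : ℕ}

section Lift

variable {X : Type*} [AddCommGroup X] [Module ℝ X]

/-! ## §1 Iterated one-coordinate lifts -/

/-- The composite of the one-coordinate lifts in the listed directions: `clifts M [ν₁,…,ν_m] = clift M ν₁ ∘ ⋯ ∘ clift M ν_m`. [folklore] -/
def clifts (M : ℕ) : List (Fin d) → (Site d → X) → (Site d → X)
  | [] => fun F => F
  | ν :: l => fun F => clift M ν (clifts M l F)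

/-- `clifts` on the empty list. [folklore] -/
@[simp] theorem clifts_nil (M : ℕ) (F : Site d → X) : clifts M [] F = F := rfl

/-- `clifts` on a cons. [folklore] -/
@[simp] theorem clifts_cons (M : ℕ) (ν : Fin d) (l : List (Fin d)) (F : Site d → X) : clifts M (ν :: l) F = clift M ν (clifts M l F) := rfl

/-- The transverse directions of `κ`, as a list. [folklore] -/
def transverse (κ : Fin d) : List (Fin d) := (List.finRange d).filter (fun ν => decide (ν ≠ κ))

omit [AddCommGroup X] [Module ℝ X] in
/-- Membership in `transverse κ`. [folklore] -/
theorem mem_transverse {κ ν : Fin d} : ν ∈ transverse κ ↔ ν ≠ κ := by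
  simp [transverse]

omit [AddCommGroup X] [Module ℝ X] in
/-- `transverse κ` has no duplicates. [folklore] -/
theorem transverse_nodup (κ : Fin d) : (transverse κ).Nodup := (List.nodup_finRange d).filter _

omit [AddCommGroup X] [Module ℝ X] in
/-- `transverse κ` has at most `d` entries. [folklore] -/
theorem length_transverse_le (κ : Fin d) : (transverse κ).length ≤ d := by
  simpa [transverse] using List.length_filter_le (fun ν => decide (ν ≠ κ)) (List.finRange d)

/-- **THE TENSOR LIFT** of a coarse 1-form component `w` in direction `κ`: `clifts M (transverse κ) (llift M N κ (w ∘ blk M))`. [folklore] -/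
def tlift (M N : ℕ) (κ : Fin d) (w : Site d → X) : Site d → X :=
  clifts M (transverse κ) (llift M N κ (fun y => w (blk M y)))

/-- `clifts` is subtractive. [folklore] -/
theorem clifts_sub (M : ℕ) : ∀ (l : List (Fin d)) (F G : Site d → X), clifts M l (F - G) = clifts M l F - clifts M l G
  | [], _, _ => rfl
  | ν :: l, F, G => by rw [clifts_cons, clifts_cons, clifts_cons, clifts_sub M l, clift_sub]

/-- `clifts` commutes with the translations `v` with `M ∣ v_ν` for every listed `ν`. [folklore] -/
theorem clifts_translate (M : ℕ) (v : Site d) :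
    ∀ (l : List (Fin d)), (∀ ν ∈ l, (M : ℤ) ∣ v ν) → ∀ F : Site d → X, clifts M l (fun y => F (y + v)) = fun y => clifts M l F (y + v)
  | [], _, _ => rfl
  | ν :: l, h, F => by
      rw [clifts_cons, clifts_cons, clifts_translate M v l (fun μ hμ => h μ (List.mem_cons_of_mem _ hμ)) F]
      exact clift_translate M ν _ v (h ν List.mem_cons_self)

/-- `clifts` preserves periodicity `P` with `M ∣ P`. [folklore] -/
theorem clifts_per {M : ℕ} {P : ℤ} (hMP : (M : ℤ) ∣ P) :
    ∀ (l : List (Fin d)) {F : Site d → X}, (∀ (y : Site d) (κ : Fin d), F (y + P • e κ) = F y) →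
      ∀ (y : Site d) (κ : Fin d), clifts M l F (y + P • e κ) = clifts M l F y
  | [], _, hF, y, κ => hF y κ
  | ν :: l, _, hF, y, κ => by
      rw [clifts_cons]
      exact clift_per hMP ν (clifts_per hMP l hF) y κ

/-- `clifts` preserves blockwise constancy in every unlisted direction. [folklore] -/
theorem clifts_bconst {M : ℕ} {μ : Fin d} :
    ∀ (l : List (Fin d)), μ ∉ l → ∀ {F : Site d → X}, (∀ y, F y = F (y - (res M y μ) • e μ)) →
      ∀ y, clifts M l F y = clifts M l F (y - (res M y μ) • e μ)
  | [], _, _, hF, y => hF y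
  | ν :: l, hμ, _, hF, y => by
      rw [clifts_cons]
      have hne : μ ≠ ν := fun h => hμ (h ▸ List.mem_cons_self)
      exact clift_bconst hne (clifts_bconst l (fun h => hμ (List.mem_cons_of_mem _ h)) hF) y

/-- `clifts` preserves values in a submodule. [folklore] -/
theorem clifts_mem (K : Submodule ℝ X) (M : ℕ) : ∀ (l : List (Fin d)) {F : Site d → X}, (∀ y, F y ∈ K) → ∀ y, clifts M l F y ∈ K
  | [], _, hF, y => hF y
  | ν :: l, _, hF, y => clift_mem K M ν (clifts_mem K M l hF) y

/-- `clifts` commutes with real-linear maps of the values. [folklore] -/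
theorem clifts_map {Y : Type*} [AddCommGroup Y] [Module ℝ Y] (φ : X →ₗ[ℝ] Y) (M : ℕ) :
    ∀ (l : List (Fin d)) (F : Site d → X) (y : Site d), φ (clifts M l F y) = clifts M l (fun x => φ (F x)) y
  | [], _, _ => rfl
  | ν :: l, F, y => by
      rw [clifts_cons, clifts_cons, clift_map]
      have : (fun x => φ (clifts M l F x)) = clifts M l (fun x => φ (F x)) := funext fun x => clifts_map φ M l F x
      rw [this]

omit [Module ℝ X] in
/-- **THE FIBRE LEMMA**: a sum over the block `q + [0,M)^d` is the sum of its line sums in direction `λ`; two functions with the same line sums in direction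
`λ` from every base point of the block face have the same block sum. [folklore] -/
theorem sum_periodBox_fibre {M : ℕ} (hM : 1 ≤ M) (lam : Fin d) (H H' : Site d → X) (q : Site d)
    (h : ∀ v ∈ periodBox (d := d) M, v lam = 0 →
      ∑ s ∈ range M, H (q + v + (s : ℤ) • e lam) = ∑ s ∈ range M, H' (q + v + (s : ℤ) • e lam)) :
    ∑ v ∈ periodBox (d := d) M, H (q + v) = ∑ v ∈ periodBox (d := d) M, H' (q + v) := by
  rw [← sum_univ_boxVec, ← sum_univ_boxVec]
  set E := Equiv.funSplitAt lam (Fin M) with hE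
  rw [← E.symm.sum_comp (fun r => H (q + boxVec M r)), ← E.symm.sum_comp (fun r => H' (q + boxVec M r)), Fintype.sum_prod_type,
    Fintype.sum_prod_type, Finset.sum_comm]
  conv_rhs => rw [Finset.sum_comm]
  refine Finset.sum_congr rfl fun r' _ => ?_
  set s₀ : Fin M := ⟨0, by omega⟩
  set v₀ : Site d := boxVec M (E.symm (s₀, r')) with hv₀
  have hkey : ∀ s : Fin M, boxVec M (E.symm (s, r')) = v₀ + ((s : ℕ) : ℤ) • e lam := by
    intro s
    funext j
    simp only [hv₀, hE, boxVec, Equiv.funSplitAt_symm_apply, Pi.add_apply, Pi.smul_apply, e_apply, smul_eq_mul]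
    by_cases hj : j = lam
    · subst hj; simp [s₀]
    · simp [hj]
  have hv₀mem : v₀ ∈ periodBox (d := d) M := Finset.mem_image.mpr ⟨_, Finset.mem_univ _, rfl⟩
  have hv₀lam : v₀ lam = 0 := by simp [hv₀, hE, boxVec, Equiv.funSplitAt_symm_apply, s₀]
  have hL : ∑ s : Fin M, H (q + boxVec M (E.symm (s, r'))) = ∑ s ∈ range M, H (q + v₀ + (s : ℤ) • e lam) := by
    simp only [hkey, ← add_assoc]
    exact Fin.sum_univ_eq_sum_range (fun s : ℕ => H (q + v₀ + (s : ℤ) • e lam)) M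
  have hR : ∑ s : Fin M, H' (q + boxVec M (E.symm (s, r'))) = ∑ s ∈ range M, H' (q + v₀ + (s : ℤ) • e lam) := by
    simp only [hkey, ← add_assoc]
    exact Fin.sum_univ_eq_sum_range (fun s : ℕ => H' (q + v₀ + (s : ℤ) • e lam)) M
  rw [hL, hR, h v₀ hv₀mem hv₀lam]

omit [AddCommGroup X] [Module ℝ X] in
/-- The offset of `q + v` in direction `ν` vanishes when those of `q` and `v` do. [folklore] -/
theorem res_add_eq_zero {M : ℕ} {q v : Site d} {ν : Fin d} (hq : res M q ν = 0) (hv : v ν = 0) : res M (q + v) ν = 0 := by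
  simp only [res, Pi.add_apply, hv, add_zero] at hq ⊢
  exact hq

/-- **BLOCK SUMS OF `clifts l G` ARE THE BLOCK SUMS OF `G`** (for `G` blockwise constant in the listed directions, read from a corner `q` with vanishing listed offsets,
`l` without duplicates, `M ≥ 1`). [folklore] -/
theorem sum_periodBox_clifts {M : ℕ} (hM : 1 ≤ M) :
    ∀ (l : List (Fin d)), l.Nodup → ∀ {G : Site d → X}, (∀ μ ∈ l, ∀ y, G y = G (y - (res M y μ) • e μ)) →
      ∀ (q : Site d), (∀ μ ∈ l, res M q μ = 0) →
        ∑ v ∈ periodBox (d := d) M, clifts M l G (q + v) = ∑ v ∈ periodBox (d := d) M, G (q + v)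
  | [], _, _, _, _, _ => rfl
  | ν :: l, hnd, G, hG, q, hq => by
      have hνl : ν ∉ l := (List.nodup_cons.mp hnd).1
      have hl : l.Nodup := (List.nodup_cons.mp hnd).2
      have hK : ∀ y, clifts M l G y = clifts M l G (y - (res M y ν) • e ν) := clifts_bconst l hνl (hG ν List.mem_cons_self)
      rw [← sum_periodBox_clifts hM l hl (fun μ hμ => hG μ (List.mem_cons_of_mem _ hμ)) q (fun μ hμ => hq μ (List.mem_cons_of_mem _ hμ))]
      refine sum_periodBox_fibre hM ν _ _ q fun v _ hv0 => ?_
      have hres : res M (q + v) ν = 0 := res_add_eq_zero (hq ν List.mem_cons_self) hv0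
      rw [clifts_cons, sum_clift_line hM ν hK hres]
      rw [Finset.sum_congr rfl fun (s : ℕ) hs => apply_start hM hK hres (s := (s : ℤ)) (by positivity) (by exact_mod_cast Finset.mem_range.mp hs)]
      rw [Finset.sum_const, Finset.card_range, ← Nat.cast_smul_eq_nsmul ℝ]

/-! ## §2 Exactness of the tensor lift -/

omit [AddCommGroup X] [Module ℝ X] in
/-- The block of a block start is the block: `blk (y − (res y)_μ e_μ) = blk y`. [folklore] -/
theorem blk_start {M : ℕ} (hM : 1 ≤ M) (y : Site d) (μ : Fin d) : blk M (y - (res M y μ) • e μ) = blk M y := by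
  refine (blk_res_eq_of hM (z := blk M y) (ρ := res M y - (res M y μ) • e μ) ?_ (fun i => ?_) (fun i => ?_)).1
  · rw [← add_sub_assoc, blk_add_res]
  · simp only [Pi.sub_apply, Pi.smul_apply, e_apply, smul_eq_mul]
    split_ifs with hi
    · subst hi; simp
    · simp only [mul_zero, sub_zero]; exact res_nonneg hM y i
  · simp only [Pi.sub_apply, Pi.smul_apply, e_apply, smul_eq_mul]
    split_ifs with hi
    · subst hi; simp only [mul_one, sub_self]; exact_mod_cast (by omega : 0 < M)
    · simp only [mul_zero, sub_zero]; exact res_lt hM y i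

omit [AddCommGroup X] [Module ℝ X] in
/-- The embedded coarse datum `w ∘ blk M` is blockwise constant in every direction. [folklore] -/
theorem comp_blk_bconst {M : ℕ} (hM : 1 ≤ M) (w : Site d → X) (μ : Fin d) (y : Site d) :
    (fun z => w (blk M z)) y = (fun z => w (blk M z)) (y - (res M y μ) • e μ) := by
  simp only [blk_start hM]

omit [AddCommGroup X] [Module ℝ X] in
/-- The embedded coarse datum of an `N`-periodic `w` is `MN`-periodic. [folklore] -/
theorem comp_blk_per {M N : ℕ} (hM : 1 ≤ M) {w : Site d → X} (hw : ∀ (z : Site d) (μ : Fin d), w (z + (N : ℤ) • e μ) = w z) (y : Site d) (μ : Fin d) :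
    (fun z => w (blk M z)) (y + ((M : ℤ) * (N : ℤ)) • e μ) = (fun z => w (blk M z)) y := by
  simp only [(blk_res_add_period hM y N μ).1, hw]

/-- **EXACTNESS OF THE TENSOR LIFT**: for `N`-periodic `w` (`M, N ≥ 1`) and every coarse site `x`,
`Σ_{v∈[0,M)^d} Σ_{i<M} tlift w (M•x + v + i•e_κ) = (M:ℝ)^d • w x` — Bałaban's one-shot block-LINE average at scale `M` of the lift returns the datum. [folklore] -/
theorem sum_block_line_tlift {M N : ℕ} (hM : 1 ≤ M) (hN : 1 ≤ N) (κ : Fin d) {w : Site d → X}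
    (hw : ∀ (z : Site d) (μ : Fin d), w (z + (N : ℤ) • e μ) = w z) (x : Site d) :
    ∑ v ∈ periodBox (d := d) M, ∑ i ∈ range M, tlift M N κ w ((M : ℤ) • x + v + (i : ℤ) • e κ) = ((M : ℝ) ^ d) • w x := by
  set vh : Site d → X := fun y => w (blk M y) with hvh
  have hvB : ∀ (μ : Fin d) (y : Site d), vh y = vh (y - (res M y μ) • e μ) := fun μ y => comp_blk_bconst hM w μ y
  have hvP : ∀ (y : Site d) (μ : Fin d), vh (y + ((M : ℤ) * (N : ℤ)) • e μ) = vh y := fun y μ => comp_blk_per hM hw y μ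
  set G : Site d → X := llift M N κ vh with hG
  have hGB : ∀ μ ∈ transverse κ, ∀ y, G y = G (y - (res M y μ) • e μ) := fun μ hμ y =>
    llift_bconst N (mem_transverse.mp hμ) (hvB μ) y
  have hq : ∀ (i : ℕ), ∀ μ ∈ transverse κ, res M ((M : ℤ) • x + (i : ℤ) • e κ) μ = 0 := by
    intro i μ hμ
    have hne : μ ≠ κ := mem_transverse.mp hμ
    rw [res_add_smul_e_ne M _ hne.symm, (SmoothRefineBlocks.blk_res_smul hM x).2]
    rfl
  -- Step 1: peel the transverse lifts
  have h1 : ∀ i : ℕ, ∑ v ∈ periodBox (d := d) M, tlift M N κ w ((M : ℤ) • x + v + (i : ℤ) • e κ)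
      = ∑ v ∈ periodBox (d := d) M, G ((M : ℤ) • x + (i : ℤ) • e κ + v) := by
    intro i
    have : ∀ v : Site d, (M : ℤ) • x + v + (i : ℤ) • e κ = (M : ℤ) • x + (i : ℤ) • e κ + v := fun v => add_right_comm _ _ _
    simp only [this, tlift]
    exact sum_periodBox_clifts hM (transverse κ) (transverse_nodup κ) hGB _ (hq i)
  rw [Finset.sum_comm]
  simp only [h1]
  -- Step 2: the longitudinal line, by the fibre lemma in direction `κ`
  rw [Finset.sum_comm]
  have h2 : ∑ v ∈ periodBox (d := d) M, ∑ i ∈ range M, G ((M : ℤ) • x + (i : ℤ) • e κ + v) = ∑ v ∈ periodBox (d := d) M, vh ((M : ℤ) • x + v) := by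
    have hsw : ∀ v : Site d, ∑ i ∈ range M, G ((M : ℤ) • x + (i : ℤ) • e κ + v) = ∑ i ∈ range M, G ((M : ℤ) • x + v + (i : ℤ) • e κ) := by
      intro v; simp only [add_right_comm _ _ v]
    simp only [hsw]
    refine sum_periodBox_fibre hM κ (fun p => ∑ i ∈ range M, G (p + (i : ℤ) • e κ)) vh ((M : ℤ) • x) fun v _ hv0 => ?_
    have hx0 : res M ((M : ℤ) • x) κ = 0 := by rw [(SmoothRefineBlocks.blk_res_smul hM x).2]; rfl
    have hres : res M ((M : ℤ) • x + v) κ = 0 := res_add_eq_zero hx0 hv0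
    have hll := sum_llift_line hM hN κ (fun y => hvP y κ) (hvB κ) hres
    have e1 : ∀ s i : ℕ, (M : ℤ) • x + v + (s : ℤ) • e κ + (i : ℤ) • e κ = (M : ℤ) • x + v + ((s : ℤ) + (i : ℤ)) • e κ := fun s i => by
      rw [add_smul, add_assoc]
    show ∑ s ∈ range M, ∑ i ∈ range M, G ((M : ℤ) • x + v + (s : ℤ) • e κ + (i : ℤ) • e κ) = _
    simp only [e1, hG, hll]
    rw [Finset.sum_congr rfl fun (s : ℕ) hs => apply_start hM (hvB κ) hres (s := (s : ℤ)) (by positivity) (by exact_mod_cast Finset.mem_range.mp hs)]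
    rw [Finset.sum_const, Finset.card_range, ← Nat.cast_smul_eq_nsmul ℝ]
  rw [h2]
  -- Step 3: the datum is constant on the block
  rw [Finset.sum_congr rfl fun v hv => show vh ((M : ℤ) • x + v) = w x by simp only [hvh, blk_block hM x hv]]
  rw [Finset.sum_const, card_periodBox, ← Nat.cast_smul_eq_nsmul ℝ, Nat.cast_pow]

/-- `tlift` preserves values in a submodule. [folklore] -/
theorem tlift_mem (K : Submodule ℝ X) (M N : ℕ) (κ : Fin d) {w : Site d → X} (hw : ∀ z, w z ∈ K) (y : Site d) : tlift M N κ w y ∈ K :=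
  clifts_mem K M _ (llift_mem K M N κ (fun _ => hw _)) y

/-- `tlift` commutes with real-linear maps of the values. [folklore] -/
theorem tlift_map {Y : Type*} [AddCommGroup Y] [Module ℝ Y] (φ : X →ₗ[ℝ] Y) (M N : ℕ) (κ : Fin d) (w : Site d → X) (y : Site d) :
    φ (tlift M N κ w y) = tlift M N κ (fun z => φ (w z)) y := by
  simp only [tlift, clifts_map, llift_map]

/-- `tlift` of an `N`-periodic datum is `MN`-periodic (`M ≥ 1`). [folklore] -/
theorem tlift_per {M N : ℕ} (hM : 1 ≤ M) (κ : Fin d) {w : Site d → X} (hw : ∀ (z : Site d) (μ : Fin d), w (z + (N : ℤ) • e μ) = w z)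
    (y : Site d) (μ : Fin d) : tlift M N κ w (y + ((M : ℤ) * (N : ℤ)) • e μ) = tlift M N κ w y :=
  clifts_per (dvd_mul_right _ _) _ (llift_per κ (comp_blk_per hM hw)) y μ

end Lift

/-! ## §3 Energy -/

section Energy

variable {X : Type*} [NormedAddCommGroup X] [NormedSpace ℝ X]

/-- **L²-stability of `clifts`**: `Σ_{y∈[0,P)^d} ‖clifts M l F y‖² ≤ 36^{|l|}·Σ_y ‖F y‖²` (`F` `P`-periodic, `M ∣ P`, `M, P ≥ 1`). [folklore] -/
theorem sum_normSq_clifts_le {M P : ℕ} (hM : 1 ≤ M) (hP : 1 ≤ P) (hMP : (M : ℤ) ∣ (P : ℤ)) :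
    ∀ (l : List (Fin d)) {F : Site d → X}, (∀ (y : Site d) (κ : Fin d), F (y + (P : ℤ) • e κ) = F y) →
      ∑ y ∈ periodBox (d := d) P, ‖clifts M l F y‖ ^ 2 ≤ 36 ^ l.length * ∑ y ∈ periodBox (d := d) P, ‖F y‖ ^ 2
  | [], _, _ => by simp
  | ν :: l, F, hF => by
      rw [clifts_cons, List.length_cons, pow_succ]
      have ih := sum_normSq_clifts_le hM hP hMP l hF
      have h := sum_normSq_clift_le (X := X) hM hP ν (clifts_per hMP l hF)
      calc ∑ y ∈ periodBox (d := d) P, ‖clift M ν (clifts M l F) y‖ ^ 2 ≤ 36 * ∑ y ∈ periodBox (d := d) P, ‖clifts M l F y‖ ^ 2 := h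
        _ ≤ 36 * (36 ^ l.length * ∑ y ∈ periodBox (d := d) P, ‖F y‖ ^ 2) := by gcongr
        _ = 36 ^ l.length * 36 * ∑ y ∈ periodBox (d := d) P, ‖F y‖ ^ 2 := by ring

/-- **A FINE DIFFERENCE IN A LISTED DIRECTION COSTS `144/M² · 36^{|l|}` × THE COARSE DIFFERENCES OF THE INPUT**: for `ν ∈ l` (`l` without duplicates), `G`
`P`-periodic (`M ∣ P`) and blockwise constant in every listed direction,
`Σ_{y∈[0,P)^d} ‖clifts l G (y + e_ν) − clifts l G y‖² ≤ 144·(1/M)²·36^{|l|}·Σ_y ‖G(y + M e_ν) − G y‖²`. [folklore] -/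
theorem sum_normSq_step_clifts_le {M P : ℕ} (hM : 1 ≤ M) (hP : 1 ≤ P) (hMP : (M : ℤ) ∣ (P : ℤ)) (ν : Fin d) :
    ∀ (l : List (Fin d)), l.Nodup → ν ∈ l → ∀ {G : Site d → X}, (∀ (y : Site d) (κ : Fin d), G (y + (P : ℤ) • e κ) = G y) →
      (∀ μ ∈ l, ∀ y, G y = G (y - (res M y μ) • e μ)) →
        ∑ y ∈ periodBox (d := d) P, ‖clifts M l G (y + e ν) - clifts M l G y‖ ^ 2
          ≤ 144 * (1 / (M : ℝ)) ^ 2 * 36 ^ l.length * ∑ y ∈ periodBox (d := d) P, ‖G (y + (M : ℤ) • e ν) - G y‖ ^ 2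
  | [], _, hν, _, _, _ => absurd hν List.not_mem_nil
  | μ :: l, hnd, hν, G, hGP, hGB => by
      have hμl : μ ∉ l := (List.nodup_cons.mp hnd).1
      have hl : l.Nodup := (List.nodup_cons.mp hnd).2
      have hKP := clifts_per (X := X) hMP l hGP
      rw [List.length_cons, pow_succ]
      by_cases hμν : μ = ν
      · subst hμν
        have hKB : ∀ y, clifts M l G y = clifts M l G (y - (res M y μ) • e μ) := clifts_bconst l hμl (hGB μ List.mem_cons_self)
        have h := sum_normSq_step_clift_le (X := X) hM hP μ hKP hKB
        have htr : (fun y => clifts M l G (y + (M : ℤ) • e μ)) - clifts M l G = clifts M l ((fun y => G (y + (M : ℤ) • e μ)) - G) := by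
          rw [clifts_sub, clifts_translate M ((M : ℤ) • e μ) l (fun μ' _ => by simp [e_apply]; split_ifs <;> simp)]
        have hDP : ∀ (y : Site d) (κ : Fin d), ((fun y => G (y + (M : ℤ) • e μ)) - G) (y + (P : ℤ) • e κ) = ((fun y => G (y + (M : ℤ) • e μ)) - G) y :=
          fun y κ => by simp only [Pi.sub_apply, add_right_comm _ _ ((M : ℤ) • e μ), hGP]
        have h2 := sum_normSq_clifts_le hM hP hMP l hDP
        have h3 : ∑ y ∈ periodBox (d := d) P, ‖clifts M l G (y + (M : ℤ) • e μ) - clifts M l G y‖ ^ 2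
            = ∑ y ∈ periodBox (d := d) P, ‖clifts M l ((fun y => G (y + (M : ℤ) • e μ)) - G) y‖ ^ 2 := by
          rw [← htr]; rfl
        simp only [clifts_cons]
        calc ∑ y ∈ periodBox (d := d) P, ‖clift M μ (clifts M l G) (y + e μ) - clift M μ (clifts M l G) y‖ ^ 2
            ≤ 144 * (1 / (M : ℝ)) ^ 2 * ∑ y ∈ periodBox (d := d) P, ‖clifts M l G (y + (M : ℤ) • e μ) - clifts M l G y‖ ^ 2 := h
          _ ≤ 144 * (1 / (M : ℝ)) ^ 2 * (36 ^ l.length * ∑ y ∈ periodBox (d := d) P, ‖G (y + (M : ℤ) • e μ) - G y‖ ^ 2) := by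
              rw [h3]; gcongr; simpa only [Pi.sub_apply] using h2
          _ ≤ 144 * (1 / (M : ℝ)) ^ 2 * (36 ^ l.length * 36) * ∑ y ∈ periodBox (d := d) P, ‖G (y + (M : ℤ) • e μ) - G y‖ ^ 2 := by
              have h0 : 0 ≤ 144 * (1 / (M : ℝ)) ^ 2 * 36 ^ l.length * ∑ y ∈ periodBox (d := d) P, ‖G (y + (M : ℤ) • e μ) - G y‖ ^ 2 := by
                positivity
              nlinarith [h0]
      · have hν' : ν ∈ l := (List.mem_cons.mp hν).resolve_left (Ne.symm hμν)
        have ih := sum_normSq_step_clifts_le hM hP hMP ν l hl hν' hGP (fun μ' hμ' => hGB μ' (List.mem_cons_of_mem _ hμ'))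
        have hd : ∀ y, clift M μ (clifts M l G) (y + e ν) - clift M μ (clifts M l G) y
            = clift M μ ((fun y => clifts M l G (y + e ν)) - clifts M l G) y := by
          intro y
          rw [clift_sub, Pi.sub_apply]
          congr 1
          have := congr_fun (clift_translate M μ (clifts M l G) (e ν) (by simp [e_apply, hμν])) y
          exact this.symm
        have hDP : ∀ (y : Site d) (κ : Fin d), ((fun y => clifts M l G (y + e ν)) - clifts M l G) (y + (P : ℤ) • e κ)
            = ((fun y => clifts M l G (y + e ν)) - clifts M l G) y := fun y κ => by
          simp only [Pi.sub_apply, add_right_comm _ _ (e ν), hKP]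
        have h1 := sum_normSq_clift_le (X := X) hM hP μ hDP
        simp only [clifts_cons, hd]
        calc ∑ y ∈ periodBox (d := d) P, ‖clift M μ ((fun y => clifts M l G (y + e ν)) - clifts M l G) y‖ ^ 2
            ≤ 36 * ∑ y ∈ periodBox (d := d) P, ‖((fun y => clifts M l G (y + e ν)) - clifts M l G) y‖ ^ 2 := h1
          _ ≤ 36 * (144 * (1 / (M : ℝ)) ^ 2 * 36 ^ l.length * ∑ y ∈ periodBox (d := d) P, ‖G (y + (M : ℤ) • e ν) - G y‖ ^ 2) := by
              gcongr; simpa only [Pi.sub_apply] using ih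
          _ = 144 * (1 / (M : ℝ)) ^ 2 * (36 ^ l.length * 36) * ∑ y ∈ periodBox (d := d) P, ‖G (y + (M : ℤ) • e ν) - G y‖ ^ 2 := by ring

/-- **THE TRANSVERSE FINE DIFFERENCES OF THE TENSOR LIFT COST `O(M^{d−4})` × THE COARSE DIFFERENCES OF THE DATUM**: for `ν ≠ κ`, `N`-periodic `w`, `M, N ≥ 1`,
`Σ_{y∈[0,MN)^d} ‖tlift w (y + e_ν) − tlift w y‖² ≤ 166176 · 36^d · (1/M)^4 · M^d · Σ_{z∈[0,N)^d} ‖w(z + e_ν) − w(z)‖²` — UNIFORM IN `M` FOR `d = 4`. [folklore] -/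
theorem sum_normSq_step_tlift_le {M N : ℕ} (hM : 1 ≤ M) (hN : 1 ≤ N) {κ ν : Fin d} (hne : ν ≠ κ) {w : Site d → X}
    (hw : ∀ (z : Site d) (μ : Fin d), w (z + (N : ℤ) • e μ) = w z) :
    ∑ y ∈ periodBox (d := d) (M * N), ‖tlift M N κ w (y + e ν) - tlift M N κ w y‖ ^ 2
      ≤ 166176 * 36 ^ d * (1 / (M : ℝ)) ^ 4 * (M : ℝ) ^ d * ∑ z ∈ periodBox (d := d) N, ‖w (z + e ν) - w z‖ ^ 2 := by
  have hP : 1 ≤ M * N := Nat.one_le_iff_ne_zero.mpr (Nat.mul_ne_zero (by omega) (by omega))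
  have hMN : ((M * N : ℕ) : ℤ) = (M : ℤ) * (N : ℤ) := by push_cast; ring
  have hMP : (M : ℤ) ∣ ((M * N : ℕ) : ℤ) := by rw [hMN]; exact dvd_mul_right _ _
  set vh : Site d → X := fun y => w (blk M y) with hvh
  have hvB : ∀ (μ : Fin d) (y : Site d), vh y = vh (y - (res M y μ) • e μ) := fun μ y => comp_blk_bconst hM w μ y
  have hvP : ∀ (y : Site d) (μ : Fin d), vh (y + ((M * N : ℕ) : ℤ) • e μ) = vh y := fun y μ => by rw [hMN]; exact comp_blk_per hM hw y μ
  set G : Site d → X := llift M N κ vh with hGdef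
  have hGP : ∀ (y : Site d) (μ : Fin d), G (y + ((M * N : ℕ) : ℤ) • e μ) = G y := fun y μ => by
    rw [hMN]; exact llift_per κ (fun y' μ' => by rw [← hMN]; exact hvP y' μ') y μ
  have hGB : ∀ μ ∈ transverse κ, ∀ y, G y = G (y - (res M y μ) • e μ) := fun μ hμ y => llift_bconst N (mem_transverse.mp hμ) (hvB μ) y
  -- Step 1: through the transverse lifts
  have h1 := sum_normSq_step_clifts_le (X := X) hM hP hMP ν (transverse κ) (transverse_nodup κ) (mem_transverse.mpr hne) hGP hGB
  -- Step 2: through the longitudinal lift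
  set D : Site d → X := (fun y => vh (y + (M : ℤ) • e ν)) - vh with hDdef
  have hD : (fun y => G (y + (M : ℤ) • e ν)) - G = llift M N κ D := by
    rw [hDdef, llift_sub, llift_translate M N κ vh ((M : ℤ) • e ν) (by simp [e_apply, hne.symm])]
  have hDP : ∀ (y : Site d) (μ : Fin d), D (y + ((M * N : ℕ) : ℤ) • e μ) = D y := fun y μ => by
    simp only [hDdef, Pi.sub_apply, add_right_comm _ _ ((M : ℤ) • e ν), hvP]
  have hDB : ∀ y, D y = D (y - (res M y κ) • e κ) := fun y => by
    simp only [hDdef, Pi.sub_apply]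
    rw [hvB κ (y + _), res_add_smul_e_ne M y hne, hvB κ y, add_sub_right_comm]
  have h2 : ∑ y ∈ periodBox (d := d) (M * N), ‖G (y + (M : ℤ) • e ν) - G y‖ ^ 2 ≤ 1154 * (1 / (M : ℝ)) ^ 2 * ∑ y ∈ periodBox (d := d) (M * N), ‖D y‖ ^ 2 := by
    have h := sum_normSq_llift_le hM hN κ hDP hDB
    rw [← hD] at h
    simpa only [Pi.sub_apply] using h
  -- Step 3: the coarse differences of the embedded datum
  have h3 : ∑ y ∈ periodBox (d := d) (M * N), ‖D y‖ ^ 2 = (M : ℝ) ^ d * ∑ z ∈ periodBox (d := d) N, ‖w (z + e ν) - w z‖ ^ 2 := by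
    rw [← sum_periodBox_blocks M N hM, Finset.mul_sum]
    refine Finset.sum_congr rfl fun z _ => ?_
    have : ∀ v ∈ periodBox (d := d) M, ‖D ((M : ℤ) • z + v)‖ ^ 2 = ‖w (z + e ν) - w z‖ ^ 2 := by
      intro v hv
      simp only [hDdef, Pi.sub_apply, hvh, blk_block hM z hv]
      rw [show (M : ℤ) • z + v + (M : ℤ) • e ν = (M : ℤ) • z + v + ((M : ℤ) * 1) • e ν by rw [mul_one], (blk_res_add_period hM _ 1 ν).1,
        blk_block hM z hv, one_smul]
    rw [Finset.sum_congr rfl this, Finset.sum_const, card_periodBox, nsmul_eq_mul, Nat.cast_pow]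
  have hl : (36 : ℝ) ^ (transverse κ).length ≤ 36 ^ d := pow_le_pow_right₀ (by norm_num) (length_transverse_le κ)
  have h0 : 0 ≤ ∑ z ∈ periodBox (d := d) N, ‖w (z + e ν) - w z‖ ^ 2 := by positivity
  calc ∑ y ∈ periodBox (d := d) (M * N), ‖tlift M N κ w (y + e ν) - tlift M N κ w y‖ ^ 2
      ≤ 144 * (1 / (M : ℝ)) ^ 2 * 36 ^ (transverse κ).length * ∑ y ∈ periodBox (d := d) (M * N), ‖G (y + (M : ℤ) • e ν) - G y‖ ^ 2 := h1
    _ ≤ 144 * (1 / (M : ℝ)) ^ 2 * 36 ^ d * (1154 * (1 / (M : ℝ)) ^ 2 * ((M : ℝ) ^ d * ∑ z ∈ periodBox (d := d) N, ‖w (z + e ν) - w z‖ ^ 2)) := by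
        rw [← h3]; gcongr
    _ = 166176 * 36 ^ d * (1 / (M : ℝ)) ^ 4 * (M : ℝ) ^ d * ∑ z ∈ periodBox (d := d) N, ‖w (z + e ν) - w z‖ ^ 2 := by ring

end Energy

end

end Summit.QuantumFields.BalabanUV.T4Continuum.NE7TensorBlockLift
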